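import Summits.QuantumAdvantage.AdviceFreeQNC0.AffBells21Descent
import Summits.QuantumAdvantage.AdviceFreeQNC0.AffBells21Characters
import HarnessLib

/-!
# Cell qa-qnc0, plan S2 engine (ROUND-20 §2.9′): BLOCK-Φ — the leaf bound with exact-identity clusters TRANSPARENT —
planner qa-qnc0-p1 g21, `Sketch21.lean` §2e, statements VERBATIM

Support for crux `RingDenseResidualLt3` (stmt-QuantumAdvantage-22907), route `DWalkThree`.  A leaf system of the
descent is made of `m` CLUSTERS: cluster `i` has centre `V i` and `n` rows `V i + σ i k` (perturbations supported in
the cluster's junta) with residues `ρ i k`.  Expanding ONLY in the characters of the centre values `u_i = ⟨V i, F⟩`,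
`(−1)^{h_i(u_i, F)} = Σ_{t ∈ 𝔽₃} Ĥ_i(t, F) ω^{t u_i}` with `|Ĥ_i(0,F)| = 1`, `Ĥ_i(±1,F) = 0` when the parity `h_i(·,F)`
does not depend on the centre value (DEGENERATE at `F`, e.g. an intact exact identity) and `|Ĥ_i| = 1/3, 2/3` otherwise;
the off-junta coins contribute a factor `|1 + ω^{γ_j}|/2 = 1/2` each.  Hence
`|bias| ≤ Σ_{t ∈ 𝔽₃^m} M_t · 2^{−wtOff(t)}` (`M_t = E_F Π_i |Ĥ_i(t_i,F)|`).

Objects VERBATIM from the planner's `exp21/Sketch21.lean` §2e: `blockB`, `blockR`, `hPar`, `blockDegen`, `habsQ`,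
`juntaAll`, `wtOff`, `MtQ`, `blockPhiQ`, `BlockPhiBound`.
PROVED here (0 sorry): **`blockPhiBound : BlockPhiBound`**: `ghat` / `ghat_inversion` (Fourier inversion on `𝔽₃` for the
cluster sign `a ↦ (−1)^{h_i(a,F)}`), `norm_ghat_le` (`‖Ĥ_i(t,F)‖ ≤ habsQ`, via the three-signs lemmas of
`AffBells21Characters`), `card_hit_block` / `prod_sign_eq_sum_ghat` (the centre-character expansion of the cluster sign),
and the off-junta decay `norm_sum_mul_stdAddChar_le_of_junta` of `AffBells21Characters`.

WHAT THIS IS NOT: no statement about the crux, (P2-complete) or the descent tree; the kernel instance of Sketch21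
(`blockPhi_instance_q4`, `native_decide`) is not repeated.
-/

namespace Summit.QuantumAdvantage.AdviceFreeQNC0

open Finset
open Literature.Computability.MetaComplexity

namespace AffBells21

/-! ## §2e statements (planner qa-qnc0-p1 g21, Sketch21.lean §2e — VERBATIM) -/

/-- Flattened rows of the cluster system: row `(i,k) ↦ V i + σ i k`. -/
def blockB (q m n : ℕ) (V : Fin m → Fin q → ZMod 3) (σ : Fin m → Fin n → Fin q → ZMod 3) : Fin (m * n) → Fin q → ZMod 3 :=
  fun kk j => V (finProdFinEquiv.symm kk).1 j + σ (finProdFinEquiv.symm kk).1 (finProdFinEquiv.symm kk).2 j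

/-- Flattened residues. -/
def blockR (m n : ℕ) (ρ : Fin m → Fin n → ZMod 3) : Fin (m * n) → ZMod 3 :=
  fun kk => ρ (finProdFinEquiv.symm kk).1 (finProdFinEquiv.symm kk).2

/-- `h_i(a, F)` : number of rows of cluster `i` hit when the centre value is `a`. -/
def hPar (q m n : ℕ) (σ : Fin m → Fin n → Fin q → ZMod 3) (ρ : Fin m → Fin n → ZMod 3) (i : Fin m) (a : ZMod 3)
    (F : Fin q → Bool) : ℕ :=
  (univ.filter fun k : Fin n => a + (∑ j : Fin q, if F j then σ i k j else 0) = ρ i k).card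

/-- Cluster `i` is DEGENERATE at `F`: its parity does not depend on the centre value (Bool-valued; no instances). -/
def blockDegen (q m n : ℕ) (σ : Fin m → Fin n → Fin q → ZMod 3) (ρ : Fin m → Fin n → ZMod 3) (i : Fin m)
    (F : Fin q → Bool) : Bool :=
  (hPar q m n σ ρ i 0 F % 2 == hPar q m n σ ρ i 1 F % 2) && (hPar q m n σ ρ i 1 F % 2 == hPar q m n σ ρ i 2 F % 2)

/-- The exact modulus `|Ĥ_i(t, F)|` ∈ {1, 0, 1/3, 2/3}. -/
def habsQ (q m n : ℕ) (σ : Fin m → Fin n → Fin q → ZMod 3) (ρ : Fin m → Fin n → ZMod 3) (i : Fin m) (t : ZMod 3)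
    (F : Fin q → Bool) : ℚ :=
  if blockDegen q m n σ ρ i F = true then (if t = 0 then 1 else 0) else (if t = 0 then 1 / 3 else 2 / 3)

/-- Coins touched by some perturbation (the union of the juntas). -/
def juntaAll (q m n : ℕ) (σ : Fin m → Fin n → Fin q → ZMod 3) : Finset (Fin q) :=
  univ.filter fun j : Fin q => ∃ i : Fin m, ∃ k : Fin n, σ i k j ≠ 0

/-- `wtOff(t)`: weight of the centre combination `Σ_i t_i V i` outside the juntas. -/
def wtOff (q m n : ℕ) (V : Fin m → Fin q → ZMod 3) (σ : Fin m → Fin n → Fin q → ZMod 3) (t : Fin m → ZMod 3) : ℕ :=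
  (univ.filter fun j : Fin q => j ∉ juntaAll q m n σ ∧ (∑ i : Fin m, t i * V i j) ≠ 0).card

/-- `M_t = E_F Π_i |Ĥ_i(t_i, F)|` (rational). -/
def MtQ (q m n : ℕ) (σ : Fin m → Fin n → Fin q → ZMod 3) (ρ : Fin m → Fin n → ZMod 3) (t : Fin m → ZMod 3) : ℚ :=
  (∑ F : Fin q → Bool, ∏ i : Fin m, habsQ q m n σ ρ i (t i) F) / (2 : ℚ) ^ q

/-- **BLOCK-Φ potential** `Σ_t M_t 2^{−wtOff(t)}` (rational, computable). -/
def blockPhiQ (q m n : ℕ) (V : Fin m → Fin q → ZMod 3) (σ : Fin m → Fin n → Fin q → ZMod 3) (ρ : Fin m → Fin n → ZMod 3) : ℚ :=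
  ∑ t : Fin m → ZMod 3, MtQ q m n σ ρ t * ((2 : ℚ)⁻¹) ^ wtOff q m n V σ t

/-- **(BLOCK-Φ) LEAF BOUND** (support; centre-character expansion + `|E_F ω^{c F_j}| = 1/2` off the juntas):
`|bias(cluster system, λ = 0)| ≤ Σ_t M_t 2^{−wtOff(t)}`. -/
def BlockPhiBound : Prop :=
  ∀ (q m n : ℕ) (V : Fin m → Fin q → ZMod 3) (σ : Fin m → Fin n → Fin q → ZMod 3) (ρ : Fin m → Fin n → ZMod 3),
    |bias q (m * n) (blockB q m n V σ) (blockR m n ρ) (fun _ => false)| ≤ (blockPhiQ q m n V σ ρ : ℝ)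

/-! ## The centre-character coefficients `Ĥ_i(t, F)` -/

variable {q m n : ℕ}

/-- `Ĥ_i(t, F) = (1/3) Σ_{a ∈ 𝔽₃} (−1)^{h_i(a,F)} ω^{−t a}`. -/
noncomputable def ghat (q m n : ℕ) (σ : Fin m → Fin n → Fin q → ZMod 3) (ρ : Fin m → Fin n → ZMod 3) (i : Fin m)
    (t : ZMod 3) (F : Fin q → Bool) : ℂ :=
  (3 : ℂ)⁻¹ * ∑ a : ZMod 3, (-1 : ℂ) ^ hPar q m n σ ρ i a F * (ZMod.stdAddChar (-t * a) : ℂ)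

/-- Fourier inversion on `𝔽₃`: `(−1)^{h_i(a,F)} = Σ_t Ĥ_i(t,F) ω^{t a}`. -/
theorem ghat_inversion (σ : Fin m → Fin n → Fin q → ZMod 3) (ρ : Fin m → Fin n → ZMod 3) (i : Fin m)
    (F : Fin q → Bool) (a : ZMod 3) :
    (-1 : ℂ) ^ hPar q m n σ ρ i a F = ∑ t : ZMod 3, ghat q m n σ ρ i t F * (ZMod.stdAddChar (t * a) : ℂ) := by
  unfold ghat
  set g : ZMod 3 → ℂ := fun c => (-1 : ℂ) ^ hPar q m n σ ρ i c F with hg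
  have h1 : ∀ t : ZMod 3,
      (3 : ℂ)⁻¹ * (∑ c : ZMod 3, g c * (ZMod.stdAddChar (-t * c) : ℂ)) * (ZMod.stdAddChar (t * a) : ℂ)
        = (3 : ℂ)⁻¹ * ∑ c : ZMod 3, g c * (ZMod.stdAddChar ((a - c) * t) : ℂ) := by
    intro t
    rw [mul_assoc, sum_mul]
    congr 1
    refine sum_congr rfl fun c _ => ?_
    rw [mul_assoc, ← AddChar.map_add_eq_mul]
    congr 2
    ring
  change g a = ∑ t : ZMod 3, (3 : ℂ)⁻¹ * (∑ c : ZMod 3, g c * (ZMod.stdAddChar (-t * c) : ℂ))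
    * (ZMod.stdAddChar (t * a) : ℂ)
  simp_rw [h1]
  rw [← mul_sum, sum_comm]
  simp_rw [← mul_sum, sum_stdAddChar_three, sub_eq_zero, mul_ite, mul_zero]
  rw [Finset.sum_ite_eq univ a]
  simp only [mem_univ, if_true]
  rw [mul_comm (g a) 3, ← mul_assoc, inv_mul_cancel₀ (by norm_num : (3 : ℂ) ≠ 0), one_mul]

/-- **`‖Ĥ_i(t, F)‖ ≤ habsQ`**: `1, 0` in the degenerate case, `1/3, 2/3` otherwise (exact values). -/
theorem norm_ghat_le (σ : Fin m → Fin n → Fin q → ZMod 3) (ρ : Fin m → Fin n → ZMod 3) (i : Fin m) (t : ZMod 3)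
    (F : Fin q → Bool) :
    ‖ghat q m n σ ρ i t F‖ ≤ ((habsQ q m n σ ρ i t F : ℚ) : ℝ) := by
  unfold ghat habsQ
  have h3 : ‖(3 : ℂ)⁻¹‖ = (3 : ℝ)⁻¹ := by simp
  have hn0 : ‖(-1 : ℂ) ^ hPar q m n σ ρ i 0 F‖ = 1 := by
    rw [norm_pow, norm_neg, norm_one, one_pow]
  by_cases hdeg : blockDegen q m n σ ρ i F = true
  · have hpar : hPar q m n σ ρ i 0 F % 2 = hPar q m n σ ρ i 1 F % 2
        ∧ hPar q m n σ ρ i 1 F % 2 = hPar q m n σ ρ i 2 F % 2 := by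
      simpa [blockDegen, Bool.and_eq_true, beq_iff_eq] using hdeg
    rw [if_pos hdeg, signedCharSum_three_degen (fun a => hPar q m n σ ρ i a F) hpar (-t), norm_mul, h3]
    by_cases ht : t = 0
    · subst ht
      rw [neg_zero, if_pos rfl, if_pos rfl, norm_mul, hn0]
      norm_num
    · have hnt : -t ≠ 0 := fun h => ht (neg_eq_zero.mp h)
      rw [if_neg hnt, if_neg ht, mul_zero, norm_zero, mul_zero]
      push_cast
      exact le_rfl
  · have hne : ¬ (hPar q m n σ ρ i 0 F % 2 = hPar q m n σ ρ i 1 F % 2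
        ∧ hPar q m n σ ρ i 1 F % 2 = hPar q m n σ ρ i 2 F % 2) := by
      simpa [blockDegen, Bool.and_eq_true, beq_iff_eq] using hdeg
    rw [if_neg hdeg, norm_mul, h3, norm_signedCharSum_three (fun a => hPar q m n σ ρ i a F) hne (-t)]
    by_cases ht : t = 0
    · subst ht
      rw [neg_zero, if_pos rfl, if_pos rfl]
      push_cast
      norm_num
    · have hnt : -t ≠ 0 := fun h => ht (neg_eq_zero.mp h)
      rw [if_neg hnt, if_neg ht]
      push_cast
      norm_num

/-- The perturbation forms only read the juntas. -/
theorem perturb_eq_of_agree (σ : Fin m → Fin n → Fin q → ZMod 3) {F F' : Fin q → Bool}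
    (hFF' : ∀ j ∈ juntaAll q m n σ, F j = F' j) (i : Fin m) (k : Fin n) :
    (∑ j : Fin q, if F j then σ i k j else 0) = ∑ j : Fin q, if F' j then σ i k j else 0 := by
  refine sum_congr rfl fun j _ => ?_
  by_cases hj : j ∈ juntaAll q m n σ
  · rw [hFF' j hj]
  · have h0 : σ i k j = 0 := by
      by_contra hne
      exact hj (by unfold juntaAll; simp only [mem_filter, mem_univ, true_and]; exact ⟨i, k, hne⟩)
    simp [h0]

/-- `h_i(a, F)` only reads the juntas. -/
theorem hPar_eq_of_agree (σ : Fin m → Fin n → Fin q → ZMod 3) (ρ : Fin m → Fin n → ZMod 3) {F F' : Fin q → Bool}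
    (hFF' : ∀ j ∈ juntaAll q m n σ, F j = F' j) (i : Fin m) (a : ZMod 3) :
    hPar q m n σ ρ i a F = hPar q m n σ ρ i a F' := by
  unfold hPar
  congr 1
  ext k
  simp only [mem_filter, mem_univ, true_and]
  rw [perturb_eq_of_agree σ hFF' i k]

/-- `Ĥ_i(t, F)` only reads the juntas. -/
theorem ghat_eq_of_agree (σ : Fin m → Fin n → Fin q → ZMod 3) (ρ : Fin m → Fin n → ZMod 3) {F F' : Fin q → Bool}
    (hFF' : ∀ j ∈ juntaAll q m n σ, F j = F' j) (i : Fin m) (t : ZMod 3) :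
    ghat q m n σ ρ i t F = ghat q m n σ ρ i t F' := by
  unfold ghat
  simp_rw [hPar_eq_of_agree σ ρ hFF']

/-! ## (BLOCK-Φ) -/

/-- The hit count of the cluster system is `Σ_i h_i(⟨V i, F⟩, F)`. -/
theorem card_hit_block (V : Fin m → Fin q → ZMod 3) (σ : Fin m → Fin n → Fin q → ZMod 3)
    (ρ : Fin m → Fin n → ZMod 3) (F : Fin q → Bool) :
    (univ.filter fun kk : Fin (m * n) => rowSum (blockB q m n V σ) kk F = blockR m n ρ kk).card
      = ∑ i : Fin m, hPar q m n σ ρ i (∑ j : Fin q, if F j then V i j else 0) F := by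
  rw [card_filter, ← finProdFinEquiv.sum_comp, Fintype.sum_prod_type]
  refine sum_congr rfl fun i _ => ?_
  unfold hPar
  rw [card_filter]
  refine sum_congr rfl fun k _ => ?_
  have hrow : rowSum (blockB q m n V σ) (finProdFinEquiv (i, k)) F
      = (∑ j : Fin q, if F j then V i j else 0) + ∑ j : Fin q, if F j then σ i k j else 0 := by
    unfold rowSum blockB
    simp only [Equiv.symm_apply_apply]
    rw [← sum_add_distrib]
    refine sum_congr rfl fun j _ => ?_
    split_ifs <;> simp
  have hres : blockR m n ρ (finProdFinEquiv (i, k)) = ρ i k := by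
    unfold blockR
    simp only [Equiv.symm_apply_apply]
  rw [hrow, hres]

/-- Centre-character expansion of the cluster sign:
`Π_i (−1)^{h_i(u_i,F)} = Σ_{t ∈ 𝔽₃^m} (Π_i Ĥ_i(t_i,F)) · ω^{⟨Σ_i t_i V i, F⟩}`. -/
theorem prod_sign_eq_sum_ghat (V : Fin m → Fin q → ZMod 3) (σ : Fin m → Fin n → Fin q → ZMod 3)
    (ρ : Fin m → Fin n → ZMod 3) (F : Fin q → Bool) :
    ∏ i : Fin m, (-1 : ℂ) ^ hPar q m n σ ρ i (∑ j : Fin q, if F j then V i j else 0) F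
      = ∑ tt : Fin m → ZMod 3, (∏ i : Fin m, ghat q m n σ ρ i (tt i) F)
          * (ZMod.stdAddChar (∑ j : Fin q, if F j then (∑ i : Fin m, tt i * V i j) else 0) : ℂ) := by
  rw [prod_congr rfl fun i _ => ghat_inversion σ ρ i F (∑ j : Fin q, if F j then V i j else 0)]
  rw [Fintype.prod_sum (fun (i : Fin m) (t : ZMod 3) =>
    ghat q m n σ ρ i t F * (ZMod.stdAddChar (t * ∑ j : Fin q, if F j then V i j else 0) : ℂ))]
  refine sum_congr rfl fun tt _ => ?_
  rw [prod_mul_distrib]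
  congr 1
  rw [← stdAddChar_sum_eq_prod, ← TwoModuli.sum_mul_linForms_eq]

/-- **(BLOCK-Φ) PROVED**: `|bias(cluster system, λ = 0)| ≤ Σ_t M_t 2^{−wtOff(t)}`. -/
theorem blockPhiBound : BlockPhiBound := by
  intro q m n V σ ρ
  classical
  -- the signed count `S` with `bias = S / 2^q`
  set S : ℝ := ∑ F : Fin q → Bool, (-1 : ℝ) ^ ((univ.filter fun kk : Fin (m * n) =>
      rowSum (blockB q m n V σ) kk F = blockR m n ρ kk).card
        + (univ.filter fun j : Fin q => (fun _ : Fin q => false) j = true ∧ F j = true).card) with hSdef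
  have hbias : bias q (m * n) (blockB q m n V σ) (blockR m n ρ) (fun _ => false) = S / (2 : ℝ) ^ q := rfl
  have hempty : ∀ F : Fin q → Bool,
      (univ.filter fun j : Fin q => (fun _ : Fin q => false) j = true ∧ F j = true).card = 0 := by
    intro F
    rw [Finset.card_eq_zero, Finset.filter_eq_empty_iff]
    intro j _ h
    exact Bool.false_ne_true h.1
  -- the coefficient of the character `t`
  set c : (Fin m → ZMod 3) → (Fin q → Bool) → ℂ := fun tt F => ∏ i : Fin m, ghat q m n σ ρ i (tt i) F with hcdef
  have hS' : S = ∑ F : Fin q → Bool,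
      (-1 : ℝ) ^ (∑ i : Fin m, hPar q m n σ ρ i (∑ j : Fin q, if F j then V i j else 0) F) := by
    rw [hSdef]
    refine sum_congr rfl fun F _ => ?_
    rw [hempty F, add_zero, card_hit_block V σ ρ F]
  have hS : (S : ℂ) = ∑ tt : Fin m → ZMod 3, ∑ F : Fin q → Bool,
      c tt F * (ZMod.stdAddChar (∑ j : Fin q, if F j then (∑ i : Fin m, tt i * V i j) else 0) : ℂ) := by
    rw [hS', Complex.ofReal_sum, sum_comm]
    refine sum_congr rfl fun F _ => ?_
    rw [Complex.ofReal_pow, Complex.ofReal_neg, Complex.ofReal_one, ← prod_pow_eq_pow_sum,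
      prod_sign_eq_sum_ghat V σ ρ F]
  -- the coefficients only read the juntas, and their total mass is `2^q · M_t`
  have hc_agree : ∀ (tt : Fin m → ZMod 3) (F F' : Fin q → Bool), (∀ j ∈ juntaAll q m n σ, F j = F' j) →
      c tt F = c tt F' := by
    intro tt F F' hFF'
    simp only [hcdef]
    exact prod_congr rfl fun i _ => ghat_eq_of_agree σ ρ hFF' i (tt i)
  have hmass : ∀ tt : Fin m → ZMod 3,
      ∑ F : Fin q → Bool, ‖c tt F‖ ≤ (2 : ℝ) ^ q * ((MtQ q m n σ ρ tt : ℚ) : ℝ) := by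
    intro tt
    have hM : (2 : ℝ) ^ q * ((MtQ q m n σ ρ tt : ℚ) : ℝ)
        = ∑ F : Fin q → Bool, ∏ i : Fin m, ((habsQ q m n σ ρ i (tt i) F : ℚ) : ℝ) := by
      unfold MtQ
      push_cast
      rw [mul_div_cancel₀ _ (by positivity)]
    rw [hM]
    refine sum_le_sum fun F _ => ?_
    simp only [hcdef]
    rw [norm_prod]
    exact prod_le_prod (fun i _ => norm_nonneg _) fun i _ => norm_ghat_le σ ρ i (tt i) F
  -- assemble
  have hSabs : |S| ≤ ∑ tt : Fin m → ZMod 3,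
      (2 : ℝ)⁻¹ ^ wtOff q m n V σ tt * ((2 : ℝ) ^ q * ((MtQ q m n σ ρ tt : ℚ) : ℝ)) := by
    rw [← Real.norm_eq_abs, ← Complex.norm_real, hS]
    refine (norm_sum_le _ _).trans (sum_le_sum fun tt _ => ?_)
    refine (norm_sum_mul_stdAddChar_le_of_junta (juntaAll q m n σ) (c tt) (hc_agree tt)
      (fun j => ∑ i : Fin m, tt i * V i j)).trans ?_
    unfold wtOff
    exact mul_le_mul_of_nonneg_left (hmass tt) (by positivity)
  rw [hbias, abs_div, abs_of_pos (by positivity : (0 : ℝ) < 2 ^ q), div_le_iff₀ (by positivity)]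
  refine hSabs.trans (le_of_eq ?_)
  unfold blockPhiQ
  push_cast
  rw [sum_mul]
  refine sum_congr rfl fun tt _ => ?_
  ring

end AffBells21

end Summit.QuantumAdvantage.AdviceFreeQNC0
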